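import Mathlib
import Literature.Analysis.FluidPDE.PineauVicolAngularMean
import Literature.Analysis.FluidPDE.IsometryInvariance
import HarnessLib

/-!
# Crux `MonopoleCoreExclusion` (stmt-NavierStokesRegularity-1965), line `axisymmetric_comparison_flow`:
# the azimuthal average of the core slice is smooth, divergence free, EXACTLY axisymmetric and
# `2V/K`-close — the datum half of the transfer stub `stub_axisymComparisonFlowOfAX`

`--supports stmt-NavierStokesRegularity-1965` (helper file; theorems only, no definitions, no `sorry`).

The registered transfer stub `stub_axisymComparisonFlowOfAX` of the line
`Cruxes/MonopoleCoreExclusion/Lines/axisymmetric_comparison_flow.lean` builds its comparison flow from the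
datum "`v(t) :=` azimuthal average of `u(t)` about the witness axis `x₀ + ℝ·Q e_z`", and its card claims
for that datum: exactly axisymmetric about the witness axis, smooth, divergence free, and `2V/K`-close to
`u(t)` on the whole core ball `B(x₀, KL)` (because `u(t)` is `V/K`-close there to the axisymmetric
profile `V·QW(Q⁻¹(· − x₀)/L)` and rotations about the axis preserve the ball).  This file proves exactly
that, REUSING the tree's angular mean of a vector field `angularMeanVec` (Pineau–Vicol (6.4),
`Literature/Analysis/FluidPDE/PineauVicolAngularMean.lean`: `isAxisymmetric_angularMeanVec`,
`contDiff_angularMeanVec`, `angularMean_divergence`, `norm_angularMeanVec_le`) conjugated by the rigid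
motion `y ↦ x₀ + Q y` of the witness:

* `norm_sub_angularMeanVec_le_of_close` — the new estimate: if `V⁻¹ g(L·)` is `K⁻¹`-close on `‖y‖ ≤ K`
  to an axisymmetric profile, then `‖g Y − ⟨g⟩_θ(Y)‖ ≤ 2V/K` for `‖Y‖ ≤ KL` (every rotated-back sample
  `R_{−θ} g(R_θ Y)` is `2V/K`-close to `g Y`, both being `V/K`-close to the same value of the
  equivariant profile; then average);
* `exists_smooth_axisym_azimuthalAverage_close` — for a smooth divergence-free slice `f` (= `u t`) with
  the closeness clause of a level-`K` axisymmetric witness `(x₀, L, V, Q, W)`: the field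
  `v₀ x := Q ⟨Q⁻¹ f(x₀ + Q ·)⟩_θ (Q⁻¹(x − x₀))` is smooth, divergence free, axisymmetric about the witness
  axis in the stub's sense (`y ↦ Q⁻¹ v₀(x₀ + Q y)` is `IsAxisymmetric`), bounded by `V`, and
  `‖f x − v₀ x‖ ≤ 2V/K` on the closed ball `‖x − x₀‖ ≤ KL`;
* `exists_smooth_axisym_azimuthalAverage_close_ball` — the same in the literal shape of the stub's
  clauses (slice `u t`, open ball `ball x₀ (K * L)`, constant `A = 2`).

WHAT THIS IS NOT.  (1) Rapid spatial decay of the datum (an axisymmetric divergence-free cut-off outside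
the core ball is still needed before any Cauchy theory applies).  (2) The CONTINUATION — and here the
stub is mis-typed: its hypothesis `AxisymSwirlRegular` (∃ SOME global classical bounded-energy solution
from axisymmetric Schwartz data) supplies neither the axisymmetry of that solution at later times (no
uniqueness in the class `IsClassicalNSSolutionOn`; the tree's `IsClassicalNSSolutionOn.isAxisymmetric_of_data`
needs `HasUniformRapidDecayOn`) nor its boundedness on `[t, T] × ℝ³`, both of which the stub's conclusion
demands; the no-blow-up form of `AX` in the standing class (cf. `axisymSwirlRegular_of_noBlowup`, the
converse direction, in the tree) is what the transfer needs.  Nothing here closes a stub, the crux, or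
says anything about Navier–Stokes regularity.
-/

noncomputable section

open Literature.Analysis.FluidPDE Set Metric MeasureTheory Real
open scoped ContDiff

namespace Summit.NavierStokesRegularity.NavierStokesRegularity.Theorems

-- the problem directory repeats the summit name (`NavierStokesRegularity/NavierStokesRegularity`)
set_option linter.dupNamespace false

namespace AzimuthalComparisonDatum

/-- Continuity of a family of rotated vectors `θ ↦ R_{φ(θ)} z(θ)` (componentwise). [folklore] -/
theorem continuous_rotZ_family {φ : ℝ → ℝ} {z : ℝ → EuclideanSpace ℝ (Fin 3)}
    (hφ : Continuous φ) (hz : Continuous z) :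
    Continuous fun θ : ℝ => rotZ (φ θ) (z θ) := by
  unfold rotZ
  refine (PiLp.continuous_toLp 2 _).comp ?_
  refine continuous_pi fun i => ?_
  have h0 : Continuous fun θ : ℝ => z θ 0 := (PiLp.continuous_apply 2 _ 0).comp hz
  have h1 : Continuous fun θ : ℝ => z θ 1 := (PiLp.continuous_apply 2 _ 1).comp hz
  have h2 : Continuous fun θ : ℝ => z θ 2 := (PiLp.continuous_apply 2 _ 2).comp hz
  have hc : Continuous fun θ : ℝ => Real.cos (φ θ) := Real.continuous_cos.comp hφ
  have hs : Continuous fun θ : ℝ => Real.sin (φ θ) := Real.continuous_sin.comp hφ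
  fin_cases i
  · exact ((hc.mul h0).sub (hs.mul h1)).congr fun p => by simp
  · exact ((hs.mul h0).add (hc.mul h1)).congr fun p => by simp
  · exact h2.congr fun p => by simp

/-- The azimuthal integrand `θ ↦ R_{−θ} g(R_θ y)` of a continuous field is continuous in the angle.
[folklore] -/
theorem continuous_azimuthalIntegrand {g : EuclideanSpace ℝ (Fin 3) → EuclideanSpace ℝ (Fin 3)}
    (hg : Continuous g) (y : EuclideanSpace ℝ (Fin 3)) :
    Continuous fun θ : ℝ => rotZ (-θ) (g (rotZ θ y)) := by
  have hA : Continuous fun θ : ℝ => rotZ θ y :=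
    continuous_rotZ_family (z := fun _ => y) continuous_id continuous_const
  have hB : Continuous fun θ : ℝ => g (rotZ θ y) := hg.comp hA
  exact continuous_rotZ_family continuous_neg hB

/-- **Averaging a pointwise sample bound.** If every rotated-back sample `R_{−θ} g(R_θ Y)` is `C`-close
to `g Y`, then so is the angular mean `⟨g⟩_θ(Y) = (2π)⁻¹ ∫₀^{2π} R_{−θ} g(R_θ Y) dθ`. [folklore] -/
theorem norm_sub_angularMeanVec_le {g : EuclideanSpace ℝ (Fin 3) → EuclideanSpace ℝ (Fin 3)}
    (hg : Continuous g) {Y : EuclideanSpace ℝ (Fin 3)} {C : ℝ}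
    (h : ∀ θ : ℝ, ‖rotZ (-θ) (g (rotZ θ Y)) - g Y‖ ≤ C) :
    ‖g Y - angularMeanVec g Y‖ ≤ C := by
  have h2π : 0 < 2 * π := by positivity
  have hHi : IntervalIntegrable (fun θ : ℝ => rotZ (-θ) (g (rotZ θ Y))) volume 0 (2 * π) :=
    (continuous_azimuthalIntegrand hg Y).intervalIntegrable _ _
  have hrepr : g Y - angularMeanVec g Y =
      (2 * π)⁻¹ • ∫ θ in (0 : ℝ)..2 * π, (g Y - rotZ (-θ) (g (rotZ θ Y))) := by
    rw [angularMeanVec_apply, intervalIntegral.integral_sub intervalIntegrable_const hHi,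
      intervalIntegral.integral_const, smul_sub, smul_smul, sub_zero,
      inv_mul_cancel₀ h2π.ne', one_smul]
  rw [hrepr, norm_smul, norm_inv, Real.norm_of_nonneg h2π.le]
  have hI : ‖∫ θ in (0 : ℝ)..2 * π, (g Y - rotZ (-θ) (g (rotZ θ Y)))‖ ≤ C * |2 * π - 0| :=
    intervalIntegral.norm_integral_le_of_norm_le_const fun θ _ => by
      rw [norm_sub_rev]; exact h θ
  rw [sub_zero, abs_of_pos h2π] at hI
  have hC : 0 ≤ C := (norm_nonneg _).trans (h 0)
  calc (2 * π)⁻¹ * ‖∫ θ in (0 : ℝ)..2 * π, (g Y - rotZ (-θ) (g (rotZ θ Y)))‖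
      ≤ (2 * π)⁻¹ * (C * (2 * π)) := by gcongr
    _ = C := by field_simp

/-- **The new estimate: closeness to an axisymmetric profile passes to the angular mean with a factor
`2`.**  If `g` is continuous and the rescaled field `y ↦ V⁻¹ g(L y)` is `K⁻¹`-close on `‖y‖ ≤ K` to an
axisymmetric profile `W` (`L, V > 0`; meaningful for `K > 0`), then `‖g Y − ⟨g⟩_θ(Y)‖ ≤ 2V/K` for `‖Y‖ ≤ K L`: with
`y = L⁻¹Y`, both `V⁻¹ g Y` and `V⁻¹ R_{−θ} g(R_θ Y)` are `K⁻¹`-close to `W y` (the second because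
`‖R_θ y‖ = ‖y‖`, `W(R_θ y) = R_θ W y` and `R_{−θ}` is an isometry). [folklore] -/
theorem norm_sub_angularMeanVec_le_of_close
    (g : EuclideanSpace ℝ (Fin 3) → EuclideanSpace ℝ (Fin 3)) (hg : Continuous g) (L V K : ℝ)
    (W : EuclideanSpace ℝ (Fin 3) → EuclideanSpace ℝ (Fin 3))
    (hL : 0 < L) (hV : 0 < V) (hW : IsAxisymmetric W)
    (hclose : ∀ y : EuclideanSpace ℝ (Fin 3), ‖y‖ ≤ K → ‖V⁻¹ • g (L • y) - W y‖ ≤ K⁻¹)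
    (Y : EuclideanSpace ℝ (Fin 3)) (hY : ‖Y‖ ≤ K * L) :
    ‖g Y - angularMeanVec g Y‖ ≤ 2 * V / K := by
  refine norm_sub_angularMeanVec_le hg fun θ => ?_
  have hlin_smul : ∀ (φ a : ℝ) (x : EuclideanSpace ℝ (Fin 3)), rotZ φ (a • x) = a • rotZ φ x :=
    fun φ a x => map_smul (rotZL φ) a x
  have hlin_sub : ∀ (φ : ℝ) (x x' : EuclideanSpace ℝ (Fin 3)), rotZ φ (x - x') = rotZ φ x - rotZ φ x' :=
    fun φ x x' => map_sub (rotZL φ) x x'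
  set y : EuclideanSpace ℝ (Fin 3) := L⁻¹ • Y with hy_def
  have hyK : ‖y‖ ≤ K := by
    rw [hy_def, norm_smul, norm_inv, Real.norm_of_nonneg hL.le, inv_mul_le_iff₀ hL]
    linarith [mul_comm K L]
  have hLy : L • y = Y := by
    rw [hy_def, smul_smul, mul_inv_cancel₀ hL.ne', one_smul]
  -- (1) closeness at `y`
  have h1 : ‖V⁻¹ • g Y - W y‖ ≤ K⁻¹ := by
    have := hclose y hyK
    rwa [hLy] at this
  -- (2) closeness at the rotated point, rotated back
  have h2 : ‖V⁻¹ • rotZ (-θ) (g (rotZ θ Y)) - W y‖ ≤ K⁻¹ := by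
    have hθy : ‖rotZ θ y‖ ≤ K := by rwa [norm_rotZ]
    have := hclose (rotZ θ y) hθy
    rw [← hlin_smul, hLy, hW θ y] at this
    have e : rotZ (-θ) (V⁻¹ • g (rotZ θ Y) - rotZ θ (W y)) =
        V⁻¹ • rotZ (-θ) (g (rotZ θ Y)) - W y := by
      rw [hlin_sub, hlin_smul, ← rotZ_add, neg_add_cancel, rotZ_zero]
    rw [← e, norm_rotZ]
    exact this
  have h3 : ‖V⁻¹ • (rotZ (-θ) (g (rotZ θ Y)) - g Y)‖ ≤ 2 * K⁻¹ := by
    have : V⁻¹ • (rotZ (-θ) (g (rotZ θ Y)) - g Y) =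
        (V⁻¹ • rotZ (-θ) (g (rotZ θ Y)) - W y) - (V⁻¹ • g Y - W y) := by
      rw [smul_sub]; abel
    rw [this]
    exact (norm_sub_le _ _).trans (by linarith)
  rw [norm_smul, norm_inv, Real.norm_of_nonneg hV.le, inv_mul_le_iff₀ hV] at h3
  calc ‖rotZ (-θ) (g (rotZ θ Y)) - g Y‖ ≤ V * (2 * K⁻¹) := h3
    _ = 2 * V / K := by rw [div_eq_mul_inv]; ring

/-- **The datum half of the transfer stub, with `A = 2`.**  Let `f : ℝ³ → ℝ³` be smooth and divergence
free (a velocity slice `u t`), bounded by `V > 0`, and suppose the recentred, rotated, rescaled slice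
`y ↦ V⁻¹ Q⁻¹ f(x₀ + L Q y)` is `K⁻¹`-close on `‖y‖ ≤ K` to an axisymmetric profile `W` (the closeness
clause of a level-`K` axisymmetric core witness; `L, K > 0`).  Then the conjugated angular mean
`v₀ x := Q ⟨Q⁻¹ f(x₀ + Q ·)⟩_θ (Q⁻¹(x − x₀))` is smooth, divergence free, EXACTLY axisymmetric about the
witness axis in the stub's sense (`y ↦ Q⁻¹ v₀(x₀ + Q y)` is `IsAxisymmetric`), bounded by `V`, and
`2V/K`-close to `f` on the closed core ball `‖x − x₀‖ ≤ K L`. [folklore] -/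
theorem exists_smooth_axisym_azimuthalAverage_close
    (f : EuclideanSpace ℝ (Fin 3) → EuclideanSpace ℝ (Fin 3)) (hf : ContDiff ℝ ∞ f)
    (hdiv : VectorCalculus.IsDivFree f) (x₀ : EuclideanSpace ℝ (Fin 3)) (L V K : ℝ)
    (Q : EuclideanSpace ℝ (Fin 3) ≃ₗᵢ[ℝ] EuclideanSpace ℝ (Fin 3))
    (W : EuclideanSpace ℝ (Fin 3) → EuclideanSpace ℝ (Fin 3))
    (hL : 0 < L) (hV : 0 < V) (hW : IsAxisymmetric W)
    (hbd : ∀ x, ‖f x‖ ≤ V)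
    (hclose : ∀ y : EuclideanSpace ℝ (Fin 3), ‖y‖ ≤ K →
      ‖V⁻¹ • Q.symm (f (x₀ + L • Q y)) - W y‖ ≤ K⁻¹) :
    ∃ v₀ : EuclideanSpace ℝ (Fin 3) → EuclideanSpace ℝ (Fin 3),
      ContDiff ℝ ∞ v₀ ∧ VectorCalculus.IsDivFree v₀ ∧
      IsAxisymmetric (fun y : EuclideanSpace ℝ (Fin 3) => Q.symm (v₀ (x₀ + Q y))) ∧
      (∀ x, ‖v₀ x‖ ≤ V) ∧
      (∀ x ∈ closedBall x₀ (K * L), ‖f x - v₀ x‖ ≤ 2 * V / K) := by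
  -- the slice in witness coordinates
  set g : EuclideanSpace ℝ (Fin 3) → EuclideanSpace ℝ (Fin 3) := fun y => Q.symm (f (x₀ + Q y))
    with hg_def
  have hgc : ContDiff ℝ ∞ g :=
    Q.symm.contDiff.comp (hf.comp (contDiff_const.add Q.contDiff))
  have hg : Continuous g := hgc.continuous
  -- `g` is divergence free: it is the conjugate by `Q⁻¹` of the translate `z ↦ f (z + x₀)`
  have hF : VectorCalculus.IsDivFree (fun z => f (z + x₀)) := by
    intro x
    have hx := hdiv (x + x₀)
    simp only [VectorCalculus.divergence] at hx ⊢
    rw [fderiv_comp_add_right]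
    exact hx
  have hgdiv : VectorCalculus.IsDivFree g := by
    have h := hF.conj_linearIsometryEquiv Q.symm
    have e : (fun y => Q.symm ((fun z => f (z + x₀)) (Q.symm.symm y))) = g := by
      funext y
      simp only [hg_def, LinearIsometryEquiv.symm_symm, add_comm]
    rwa [e] at h
  -- the angular mean of `g`: smooth, divergence free, axisymmetric, bounded, close
  have hbar_cd : ContDiff ℝ ∞ (angularMeanVec g) := contDiff_angularMeanVec hgc
  have hbar_div : VectorCalculus.IsDivFree (angularMeanVec g) := by
    intro y
    have h1 : ContDiff ℝ 1 g := hgc.of_le (by exact_mod_cast le_top)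
    rw [← congrFun (angularMean_divergence h1) y]
    have hz : (VectorCalculus.divergence g) = fun _ => (0 : ℝ) := funext fun x => hgdiv x
    rw [hz]
    have hconst : IsAxisymmetricScalar (fun _ : EuclideanSpace ℝ (Fin 3) => (0 : ℝ)) := fun _ _ => rfl
    rw [hconst.angularMean_eq]
  have hbar_ax : IsAxisymmetric (angularMeanVec g) := isAxisymmetric_angularMeanVec g
  have hbar_bd : ∀ y, ‖angularMeanVec g y‖ ≤ V := fun y =>
    norm_angularMeanVec_le (b := fun _ => V) (fun x => by
      rw [hg_def]; simp only [LinearIsometryEquiv.norm_map]; exact hbd _) y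
  have hclose_g : ∀ y : EuclideanSpace ℝ (Fin 3), ‖y‖ ≤ K → ‖V⁻¹ • g (L • y) - W y‖ ≤ K⁻¹ := by
    intro y hy
    have e : x₀ + L • Q y = x₀ + Q (L • y) := by rw [map_smul]
    have := hclose y hy
    rw [e] at this
    exact this
  have hbar_close : ∀ Y : EuclideanSpace ℝ (Fin 3), ‖Y‖ ≤ K * L →
      ‖g Y - angularMeanVec g Y‖ ≤ 2 * V / K :=
    norm_sub_angularMeanVec_le_of_close g hg L V K W hL hV hW hclose_g
  -- conjugate back by the rigid motion `y ↦ x₀ + Q y`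
  refine ⟨fun x => Q (angularMeanVec g (Q.symm (x - x₀))), ?_, ?_, ?_, ?_, ?_⟩
  · exact Q.contDiff.comp (hbar_cd.comp (Q.symm.contDiff.comp (contDiff_id.sub contDiff_const)))
  · -- divergence free: conjugate by `Q`, then translate by `-x₀`
    set Φ : EuclideanSpace ℝ (Fin 3) → EuclideanSpace ℝ (Fin 3) :=
      fun y => Q (angularMeanVec g (Q.symm y)) with hΦ
    have h1 : VectorCalculus.IsDivFree Φ := hbar_div.conj_linearIsometryEquiv Q
    have h2 : VectorCalculus.IsDivFree (fun x => Φ (x + -x₀)) := by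
      intro x
      have hx := h1 (x + -x₀)
      simp only [VectorCalculus.divergence] at hx ⊢
      rw [fderiv_comp_add_right]
      exact hx
    have e : (fun x => Q (angularMeanVec g (Q.symm (x - x₀)))) = fun x => Φ (x + -x₀) := by
      funext x; simp only [hΦ, sub_eq_add_neg]
    rw [e]
    exact h2
  · intro φ y
    simp only [add_sub_cancel_left, LinearIsometryEquiv.symm_apply_apply]
    exact hbar_ax φ y
  · intro x
    rw [LinearIsometryEquiv.norm_map]
    exact hbar_bd _
  · intro x hx
    set Y : EuclideanSpace ℝ (Fin 3) := Q.symm (x - x₀) with hY_def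
    have hY : ‖Y‖ ≤ K * L := by
      rw [hY_def, LinearIsometryEquiv.norm_map, ← dist_eq_norm]
      exact mem_closedBall.1 hx
    have hfx : f x = Q (g Y) := by
      rw [hg_def, hY_def]
      simp
    rw [hfx, ← map_sub, LinearIsometryEquiv.norm_map]
    exact hbar_close Y hY

/-- **The same, in the literal shape of the stub's clauses** (slice `u t`, open core ball
`ball x₀ (K * L)`, constant `A = 2`): for a smooth divergence-free slice `u t` carrying the closeness
clause of a level-`K` axisymmetric witness, the conjugated angular mean `v₀` is smooth, divergence free,
axisymmetric about the witness axis, bounded by `V`, and `‖u t x - v₀ x‖ ≤ 2 * V / K` on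
`ball x₀ (K * L)`.  This is the datum from which `stub_axisymComparisonFlowOfAX` wants to launch its
comparison flow; the cut-off to rapid decay and the axisymmetric bounded continuation on `[t, T]` are NOT
done here (see the module docstring for why `AxisymSwirlRegular` as typed does not give the latter).
[folklore] -/
theorem exists_smooth_axisym_azimuthalAverage_close_ball
    (u : ℝ → EuclideanSpace ℝ (Fin 3) → EuclideanSpace ℝ (Fin 3)) (t : ℝ)
    (hu : ContDiff ℝ ∞ (u t)) (hdiv : VectorCalculus.IsDivFree (u t))
    (x₀ : EuclideanSpace ℝ (Fin 3)) (L V K : ℝ)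
    (Q : EuclideanSpace ℝ (Fin 3) ≃ₗᵢ[ℝ] EuclideanSpace ℝ (Fin 3))
    (W : EuclideanSpace ℝ (Fin 3) → EuclideanSpace ℝ (Fin 3))
    (hL : 0 < L) (hV : 0 < V) (hW : IsAxisymmetric W)
    (hbd : ∀ x, ‖u t x‖ ≤ V)
    (hclose : ∀ y : EuclideanSpace ℝ (Fin 3), ‖y‖ ≤ K →
      ‖V⁻¹ • Q.symm (u t (x₀ + L • Q y)) - W y‖ ≤ K⁻¹) :
    ∃ v₀ : EuclideanSpace ℝ (Fin 3) → EuclideanSpace ℝ (Fin 3),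
      ContDiff ℝ ∞ v₀ ∧ VectorCalculus.IsDivFree v₀ ∧
      IsAxisymmetric (fun y : EuclideanSpace ℝ (Fin 3) => Q.symm (v₀ (x₀ + Q y))) ∧
      (∀ x, ‖v₀ x‖ ≤ V) ∧
      (∀ x ∈ ball x₀ (K * L), ‖u t x - v₀ x‖ ≤ 2 * V / K) := by
  obtain ⟨v₀, hcd, hdv, hax, hbd', hcl⟩ :=
    exists_smooth_axisym_azimuthalAverage_close (u t) hu hdiv x₀ L V K Q W hL hV hW hbd hclose
  exact ⟨v₀, hcd, hdv, hax, hbd', fun x hx => hcl x (ball_subset_closedBall hx)⟩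

end AzimuthalComparisonDatum

end Summit.NavierStokesRegularity.NavierStokesRegularity.Theorems

end
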